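import Mathlib
import Literature.Computability.Complexity.LindseyLemma
import Summits.PneNP.PneNP.Theorems.RamseyUncertifiableRegularResolutionRungTrapSparseFalseGraph

/-!
# Character sums over `F₂^d` (helper 3/5 for `stub_not_biDenseTrapSparse`)

The additive character `chi : ZMod 2 → ℝ` (`chi 0 = 1`, `chi 1 = -1`), the bridge
`chi ⟪x, y⟫ = ipSign x y` to the tree's Lindsey lemma (`Literature/Computability/Complexity/LindseyLemma.lean`),
and the weighted discrepancy bound we use for every block of the points/hyperplanes graph:
`|Σ_{x,y} f x · g y · chi ⟪x,y⟫| ≤ √((Σ f²) · 2^d · (Σ g²))`. [folklore]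
-/

noncomputable section

open Finset Matrix
open Literature.Computability.Complexity (ipSign ipSign_eq_pow lindsey_sq)

namespace Summit.PneNP.PneNP.Cruxes.RegularResolutionRung.SoundPathBottleneck.HadamardWitness

set_option linter.dupNamespace false -- `Summit.PneNP.PneNP.…`: single-conjunct summit (D-0017)

variable {d : ℕ}

/-- The nontrivial additive character of `F₂`, real-valued. -/
def chi (u : ZMod 2) : ℝ := if u = 0 then 1 else -1

/-- `χ(0) = 1`. -/
@[simp] theorem chi_zero : chi 0 = 1 := by simp [chi]
/-- `χ(1) = -1`. -/
@[simp] theorem chi_one : chi 1 = -1 := by simp [chi]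
/-- `1 + 1 = 0` in `F₂`. -/
theorem one_add_one_zmod2 : (1 : ZMod 2) + 1 = 0 := by decide
/-- The two elements of `F₂`. -/
theorem zmod2_cases (u : ZMod 2) : u = 0 ∨ u = 1 := by revert u; decide
/-- `χ` is multiplicative. -/
theorem chi_add (u v : ZMod 2) : chi (u + v) = chi u * chi v := by
  rcases zmod2_cases u with rfl | rfl <;> rcases zmod2_cases v with rfl | rfl <;>
    simp [chi, one_add_one_zmod2]
/-- `χ² = 1`. -/
theorem chi_sq (u : ZMod 2) : chi u ^ 2 = 1 := by rcases zmod2_cases u with rfl | rfl <;> simp [chi]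
/-- `|χ| = 1`. -/
theorem abs_chi (u : ZMod 2) : |chi u| = 1 := by rcases zmod2_cases u with rfl | rfl <;> simp [chi]
/-- `|χ| ≤ 1`. -/
theorem abs_chi_le (u : ZMod 2) : |chi u| ≤ 1 := (abs_chi u).le
/-- Indicator of `u = 0` through the character. -/
theorem indicator_eq_zero (u : ZMod 2) : (if u = 0 then (1 : ℝ) else 0) = (1 + chi u) / 2 := by
  rcases zmod2_cases u with rfl | rfl <;> simp [chi]
/-- Indicator of `u = 1` through the character. -/
theorem indicator_eq_one (u : ZMod 2) : (if u = 1 then (1 : ℝ) else 0) = (1 - chi u) / 2 := by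
  rcases zmod2_cases u with rfl | rfl <;> simp [chi]

/-- `chi` of a finite sum is the product of the `chi`'s. -/
theorem chi_sum {ι : Type*} (s : Finset ι) (f : ι → ZMod 2) : chi (∑ i ∈ s, f i) = ∏ i ∈ s, chi (f i) := by
  classical
  induction s using Finset.induction_on with
  | empty => simp
  | insert i s hi ih => rw [Finset.sum_insert hi, Finset.prod_insert hi, chi_add, ih]

/-- The coordinate map `F₂^d → {0,1}^d` (`1 ↦ true`). -/
def toB (x : Vec d) : Fin d → Bool := fun i => decide (x i = 1)

/-- Round trip on one coordinate. -/
theorem zmod2_ofBool_toB (u : ZMod 2) : (if decide (u = 1) = true then (1 : ZMod 2) else 0) = u := by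
  rcases zmod2_cases u with rfl | rfl <;> simp

/-- The coordinate bijection `F₂^d ≃ {0,1}^d`. -/
def vecEquivBool (d : ℕ) : Vec d ≃ (Fin d → Bool) where
  toFun := toB
  invFun y i := if y i then 1 else 0
  left_inv x := by
    funext i
    simp only [toB]
    exact zmod2_ofBool_toB (x i)
  right_inv y := by
    funext i
    simp only [toB]
    rcases Bool.eq_false_or_eq_true (y i) with h | h <;> simp [h]

/-- Pointwise bridge: `chi (u v) = -1` iff both bits are `1`. -/
theorem chi_mul_eq (u v : ZMod 2) :
    chi (u * v) = (if (decide (u = 1) && decide (v = 1)) = true then (-1 : ℝ) else 1) := by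
  rcases zmod2_cases u with rfl | rfl <;> rcases zmod2_cases v with rfl | rfl <;> simp [chi]

/-- **Bridge to Lindsey.** `chi ⟪x, y⟫ = ipSign (toB x) (toB y)`. -/
theorem chi_dotProduct (x y : Vec d) : chi (x ⬝ᵥ y) = ipSign (toB x) (toB y) := by
  rw [dotProduct, chi_sum]
  unfold ipSign
  refine Finset.prod_congr rfl fun i _ => ?_
  rw [chi_mul_eq]
  rfl

/-- **Weighted discrepancy of the character matrix** (Lindsey's lemma transported to `F₂^d`):
`(Σ_{x,y} f x · g y · chi ⟪x,y⟫)² ≤ (Σ f²) · (2^d · Σ g²)`. -/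
theorem charSum_sq_le (f g : Vec d → ℝ) :
    (∑ x, ∑ y, f x * g y * chi (x ⬝ᵥ y)) ^ 2 ≤ (∑ x, f x ^ 2) * ((2 : ℝ) ^ d * ∑ y, g y ^ 2) := by
  set E := vecEquivBool d with hE
  have key := lindsey_sq (n := Fin d) (f ∘ E.symm) (g ∘ E.symm)
  rw [Fintype.card_fin] at key
  have h1 : ∑ x, ∑ y, f x * g y * chi (x ⬝ᵥ y) =
      ∑ x', ∑ y', (f ∘ E.symm) x' * (g ∘ E.symm) y' * ipSign x' y' := by
    rw [← E.sum_comp]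
    refine Finset.sum_congr rfl fun x _ => ?_
    rw [← E.sum_comp]
    refine Finset.sum_congr rfl fun y _ => ?_
    simp only [Function.comp, Equiv.symm_apply_apply, chi_dotProduct]
    rfl
  have h2 : ∑ x, f x ^ 2 = ∑ x', (f ∘ E.symm) x' ^ 2 := by
    rw [← E.sum_comp]; simp
  have h3 : ∑ y, g y ^ 2 = ∑ y', (g ∘ E.symm) y' ^ 2 := by
    rw [← E.sum_comp]; simp
  rw [h1, h2, h3]
  exact key

/-- Absolute-value form: `|Σ_{x,y} f x g y chi⟪x,y⟫| ≤ √((Σ f²) · 2^d · (Σ g²))`. -/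
theorem abs_charSum_le (f g : Vec d → ℝ) :
    |∑ x, ∑ y, f x * g y * chi (x ⬝ᵥ y)| ≤ Real.sqrt ((∑ x, f x ^ 2) * ((2 : ℝ) ^ d * ∑ y, g y ^ 2)) := by
  rw [← Real.sqrt_sq_eq_abs]
  exact Real.sqrt_le_sqrt (charSum_sq_le f g)

/-- At most two hyperplanes share a normal vector. -/
theorem card_fiber_normal_le (S : Finset (Hyp d)) (a : Vec d) : (S.filter fun p => p.a = a).card ≤ 2 := by
  have h := Finset.card_le_card_of_injOn (s := S.filter fun p => p.a = a) (t := (univ : Finset (ZMod 2)))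
    (fun p => p.b) (fun _ _ => Finset.mem_coe.2 (Finset.mem_univ _)) ?_
  · simpa [ZMod.card] using h
  · intro p₁ h₁ p₂ h₂ hb
    simp only [Finset.coe_filter, Set.mem_setOf_eq] at h₁ h₂
    apply Subtype.ext
    exact Prod.ext (h₁.2.trans h₂.2.symm) hb

/-- The weighted sums we meet: a weight on hyperplane NORMALS obtained by summing a function bounded by
`1` over the (at most two) hyperplanes of `S` with a given normal has squares summing to at most `2|S|`. -/
theorem sum_sq_fiberWeight_le (S : Finset (Hyp d)) (φ : Hyp d → ℝ) (hφ : ∀ p, |φ p| ≤ 1) :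
    ∑ a : Vec d, (∑ p ∈ S.filter (fun p => p.a = a), φ p) ^ 2 ≤ 2 * S.card := by
  have hpt : ∀ a : Vec d,
      (∑ p ∈ S.filter (fun p => p.a = a), φ p) ^ 2 ≤ 2 * ((S.filter fun p => p.a = a).card : ℝ) := by
    intro a
    set F := S.filter fun p => p.a = a with hF
    have hc : (F.card : ℝ) ≤ 2 := by exact_mod_cast card_fiber_normal_le S a
    have habs : |∑ p ∈ F, φ p| ≤ F.card := by
      calc |∑ p ∈ F, φ p| ≤ ∑ p ∈ F, |φ p| := Finset.abs_sum_le_sum_abs _ _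
        _ ≤ ∑ _p ∈ F, (1 : ℝ) := Finset.sum_le_sum fun p _ => hφ p
        _ = F.card := by simp
    have h0 : (0 : ℝ) ≤ F.card := Nat.cast_nonneg _
    calc (∑ p ∈ F, φ p) ^ 2 = |∑ p ∈ F, φ p| ^ 2 := (sq_abs _).symm
      _ ≤ (F.card : ℝ) ^ 2 := pow_le_pow_left₀ (abs_nonneg _) habs 2
      _ ≤ 2 * F.card := by nlinarith
  have hsum : ∑ a : Vec d, ((S.filter fun p => p.a = a).card : ℝ) = S.card := by
    have := Finset.card_eq_sum_card_fiberwise (f := fun p : Hyp d => p.a) (s := S) (t := univ)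
      (fun _ _ => Finset.mem_univ _)
    rw [this]
    push_cast
    rfl
  calc ∑ a : Vec d, (∑ p ∈ S.filter (fun p => p.a = a), φ p) ^ 2
      ≤ ∑ a : Vec d, 2 * ((S.filter fun p => p.a = a).card : ℝ) := Finset.sum_le_sum fun a _ => hpt a
    _ = 2 * S.card := by rw [← Finset.mul_sum, hsum]

/-- **Block bound, point side × normal side.** For `f` supported weights on points bounded by `1` in
absolute value and supported on `T`, and a hyperplane set `S` with weights `φ` bounded by `1`:
`|Σ_{x} Σ_{p ∈ S} f x · φ p · chi ⟪a_p, x⟫| ≤ √(|T| · 2^d · 2|S|)`. -/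
theorem abs_blockSum_le (T : Finset (Vec d)) (S : Finset (Hyp d)) (f : Vec d → ℝ) (φ : Hyp d → ℝ)
    (hf : ∀ x, |f x| ≤ 1) (hfT : ∀ x, x ∉ T → f x = 0) (hφ : ∀ p, |φ p| ≤ 1) :
    |∑ x ∈ T, ∑ p ∈ S, f x * φ p * chi (p.a ⬝ᵥ x)| ≤ Real.sqrt (T.card * ((2 : ℝ) ^ d * (2 * S.card))) := by
  -- rewrite as a full character sum with the fibre weight on normals
  set w : Vec d → ℝ := fun a => ∑ p ∈ S.filter (fun p => p.a = a), φ p with hw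
  have h1 : ∑ x ∈ T, ∑ p ∈ S, f x * φ p * chi (p.a ⬝ᵥ x) = ∑ x, ∑ p ∈ S, f x * φ p * chi (p.a ⬝ᵥ x) :=
    Finset.sum_subset (Finset.subset_univ T) (fun x _ hx => by simp [hfT x hx])
  have h2 : ∀ x : Vec d, ∑ p ∈ S, f x * φ p * chi (p.a ⬝ᵥ x) = ∑ a, f x * w a * chi (x ⬝ᵥ a) := by
    intro x
    rw [← Finset.sum_fiberwise_of_maps_to (s := S) (t := (univ : Finset (Vec d))) (g := fun p : Hyp d => p.a)
      (fun _ _ => Finset.mem_univ _) (fun p => f x * φ p * chi (p.a ⬝ᵥ x))]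
    refine Finset.sum_congr rfl fun a _ => ?_
    rw [hw]
    simp only
    rw [Finset.mul_sum, Finset.sum_mul]
    refine Finset.sum_congr rfl fun p hp => ?_
    rw [Finset.mem_filter] at hp
    rw [hp.2, dotProduct_comm]
  have hrew : ∑ x ∈ T, ∑ p ∈ S, f x * φ p * chi (p.a ⬝ᵥ x) = ∑ x, ∑ a, f x * w a * chi (x ⬝ᵥ a) := by
    rw [h1]
    exact Finset.sum_congr rfl fun x _ => h2 x
  rw [hrew]
  refine (abs_charSum_le f w).trans (Real.sqrt_le_sqrt ?_)
  have hf2 : ∑ x, f x ^ 2 ≤ T.card := by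
    have e : ∑ x ∈ T, f x ^ 2 = ∑ x, f x ^ 2 :=
      Finset.sum_subset (Finset.subset_univ T) (fun x _ hx => by simp [hfT x hx])
    rw [← e]
    calc ∑ x ∈ T, f x ^ 2 ≤ ∑ _x ∈ T, (1 : ℝ) := Finset.sum_le_sum fun x _ => by
            have := hf x
            exact (sq_le_one_iff_abs_le_one _).2 this
      _ = T.card := by simp
  have hw2 : ∑ a, w a ^ 2 ≤ 2 * S.card := sum_sq_fiberWeight_le S φ hφ
  have h2d : (0 : ℝ) ≤ (2 : ℝ) ^ d := by positivity
  have hwnn : (0 : ℝ) ≤ ∑ a, w a ^ 2 := Finset.sum_nonneg fun a _ => sq_nonneg _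
  exact mul_le_mul hf2 (mul_le_mul_of_nonneg_left hw2 h2d) (by positivity) (Nat.cast_nonneg _)

/-- Anchor (registered sub-goal `hw_charSum_anchor` of stmt-PneNP-9818): the Lindsey-type block bound. -/
theorem hw_charSum_anchor : ∀ (d : ℕ) (T : Finset (Vec d)) (S : Finset (Hyp d)) (f : Vec d → ℝ) (φ : Hyp d → ℝ),
    (∀ x, |f x| ≤ 1) → (∀ x, x ∉ T → f x = 0) → (∀ p, |φ p| ≤ 1) →
    |∑ x ∈ T, ∑ p ∈ S, f x * φ p * chi (p.a ⬝ᵥ x)| ≤ Real.sqrt (T.card * ((2 : ℝ) ^ d * (2 * S.card))) :=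
  fun _ T S f φ hf hfT hφ => abs_blockSum_le T S f φ hf hfT hφ

end Summit.PneNP.PneNP.Cruxes.RegularResolutionRung.SoundPathBottleneck.HadamardWitness

end
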